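import Mathlib
import Summits.Ventures.PercRepro2.Graph
import Summits.Ventures.PercRepro2.Exploration
import Summits.Ventures.PercRepro2.Harris
import Summits.Ventures.PercRepro2.GibbsPAJoint
import Summits.Ventures.PercRepro2.SepClusterJoint
import Summits.Ventures.PercRepro2.SepClusterSupport
import Summits.Ventures.PercRepro2.SepClusterHarris
import Summits.Ventures.PercRepro2.SepFamJoint
import Summits.Ventures.PercRepro2.SepFamSupport
import Summits.Ventures.PercRepro2.SepFamHarris
import Summits.Ventures.PercRepro2.SepFamPA

/-!
# Conditioning on more separation shrinks the clusters (blind cell PercRepro2, p3 g12,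
2026-08-27; `proofs/P3-G2.md` §5, corollary (SHRINK) for root sets)

For `W ⊆ W'` disjoint from `Y` and a monotone `g` of the tuple of clusters of `Y`:
  `P(W ↮ Y) · E[1_{W' ↮ Y} · g(expl Y)] ≤ E[1_{W ↮ Y} · g(expl Y)] · P(W' ↮ Y)`
(`sep_fam_shrink`): the tuple of clusters of `Y` conditioned on `W' ↮ Y` is stochastically
smaller than conditioned on `W ↮ Y`.  Proof: `1_{W' ↮ Y} = 1_{W ↮ Y} · h(expl Y)` with
`h(t) = 1[no root of W' lies in foot t]` antitone, then Theorem A (`sep_fam_pa`) for `g` and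
`−h`.  Own work; standard axioms.
-/

namespace Summit.Ventures.PercRepro2

namespace SepPA

open Finset Classical

section FamilyShrink

variable {V : Type*} {E : Type*} [Fintype V] [Fintype E] [DecidableEq E]
variable (ends : E → Sym2 V) (p : E → ℝ)

/-- The avoidance indicator of a family `W'` on a tuple. -/
noncomputable def avoidInd (W' Y : Finset V) (t : Y → Set V) : ℝ :=
  if ∀ x ∈ W', x ∉ foot t then 1 else 0

omit [Fintype E] [DecidableEq E] in
/-- The avoidance indicator is antitone. -/
lemma antitone_avoidInd (W' Y : Finset V) : Antitone (avoidInd W' Y) := by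
  intro t t' h
  unfold avoidInd
  by_cases h' : ∀ x ∈ W', x ∉ foot t'
  · have : ∀ x ∈ W', x ∉ foot t := fun x hx hxt => h' x hx (foot_mono h hxt)
    rw [if_pos h', if_pos this]
  · simp only [h', if_false]
    split_ifs <;> norm_num

omit [Fintype E] [DecidableEq E] in
/-- `1_{W' ↮ Y} = 1_{W ↮ Y} · avoidInd W' (expl Y)` for `W ⊆ W'`. -/
lemma ite_sepFam_eq {W W' Y : Finset V} (hWW' : W ⊆ W') (ω : Config E) :
    (if ω ∈ sepFam ends W' Y then (1 : ℝ) else 0) =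
      (if ω ∈ sepFam ends W Y then (1 : ℝ) else 0) * avoidInd W' Y (expl ends ω Y) := by
  have key : ω ∈ sepFam ends W' Y ↔ ∀ x ∈ W', x ∉ foot (expl ends ω Y) := by
    constructor
    · rintro hS x hx ⟨y, hy⟩
      exact hS x hx y y.2 (conn_symm hy)
    · intro h x hx y hy hc
      exact h x hx ⟨⟨y, hy⟩, conn_symm hc⟩
  have sub : sepFam ends W' Y ⊆ sepFam ends W Y := fun ω' hω' x hx => hω' x (hWW' hx)
  unfold avoidInd
  by_cases hS' : ω ∈ sepFam ends W' Y
  · have h1 := key.mp hS'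
    rw [if_pos hS', if_pos (sub hS'), if_pos h1]
    ring
  · have h1 : ¬ ∀ x ∈ W', x ∉ foot (expl ends ω Y) := fun h => hS' (key.mpr h)
    rw [if_neg hS', if_neg h1, mul_zero]

/-- **(SHRINK)**: conditioning on more separation makes the tuple of clusters stochastically
smaller. -/
theorem sep_fam_shrink (hp01 : ∀ e, 0 < p e ∧ p e < 1) {W W' Y : Finset V} (hWW' : W ⊆ W')
    (hXY : Disjoint W' Y) (g : (Y → Set V) → ℝ) (hg : Monotone g) :
    prob p (sepFam ends W Y) *
      expect p (fun ω => (sepFam ends W' Y).indicator (fun _ => (1 : ℝ)) ω * g (expl ends ω Y)) ≤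
    expect p (fun ω => (sepFam ends W Y).indicator (fun _ => (1 : ℝ)) ω * g (expl ends ω Y)) *
      prob p (sepFam ends W' Y) := by
  have hXY' : Disjoint W Y := Finset.disjoint_of_subset_left hWW' hXY
  have hneg : Monotone (fun t => -avoidInd W' Y t) := by
    intro t t' h
    have := antitone_avoidInd W' Y h
    show -avoidInd W' Y t ≤ -avoidInd W' Y t'
    linarith
  have H := sep_fam_pa ends p hp01 hXY' g (fun t => -avoidInd W' Y t) hg hneg
  -- rewrite the three expectations
  have e1 : expect p (fun ω => (sepFam ends W Y).indicator (fun _ => (1 : ℝ)) ω *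
      (-avoidInd W' Y (expl ends ω Y))) = -prob p (sepFam ends W' Y) := by
    rw [prob_eq_expect_indicator]
    unfold expect
    rw [← Finset.sum_neg_distrib]
    apply Finset.sum_congr rfl
    intro ω _
    simp only [Set.indicator_apply, Pi.one_apply]
    rw [ite_sepFam_eq ends hWW' ω]
    ring
  have e2 : expect p (fun ω => (sepFam ends W Y).indicator (fun _ => (1 : ℝ)) ω *
      (g (expl ends ω Y) * -avoidInd W' Y (expl ends ω Y))) =
      -expect p (fun ω => (sepFam ends W' Y).indicator (fun _ => (1 : ℝ)) ω * g (expl ends ω Y)) := by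
    unfold expect
    rw [← Finset.sum_neg_distrib]
    apply Finset.sum_congr rfl
    intro ω _
    simp only [Set.indicator_apply]
    rw [ite_sepFam_eq ends hWW' ω]
    ring
  rw [e1, e2] at H
  linarith

end FamilyShrink

end SepPA

end Summit.Ventures.PercRepro2
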